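import Literature.Topology.FourManifolds.SurfaceGroupCayleyPaths
import HarnessLib

/-!
# The Cayley complex of the surface group: faces and the two-faces lemma

Topic `Literature/Topology/FourManifolds`.  Second file of pillar **(B)** (planar counting,
Zieschang–Vogt–Coldewey Thm. 5.4.2 / Cor. 5.4.3) of the algebraic proof of Nielsen's theorem
(`SurfaceGroupNielsenSetup.lean`, `SurfaceGroupCayleyPaths.lean`).

The faces of the Cayley complex of `S_g = ⟨a, b ∣ r_g⟩` are the translates `F · D` of the closed
path `D` reading the relator word `r_g = a₀b₀a₀⁻¹b₀⁻¹a₁…` from the vertex `1`; the boundary chain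
of the face `F` is `faceB F = trav F r_g`.  Here:

* the prefix vertices `rvtx g k = r_g.take k` of the relator (pairwise distinct for `k < 4g` by
  `SurfaceGroupRelatorCircuit.lean`), their values inside the `i`-th block
  (`rvtx_block_one` … `rvtx_block_four`), the position `pos ℓ < 4g` of a letter `ℓ` in `r_g`
  (`getElem_pos`, `rvtx_pos_succ`);
* the two faces at the edge along which a letter `ℓ` leaves a vertex `u`: the face `sface u ℓ`
  whose boundary reads `ℓ` there, and the other one `oface u ℓ` (`oface_eq_sface_linv`); the two
  faces `Fplus e`, `Fminus e` of a directed edge `e` (`Fplus_edgeOf_of_snd` …);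
* the **two-faces lemma** `faceB_apply`: `faceB F e = [F = Fplus e] - [F = Fminus e]` — every
  directed edge lies on the boundary of exactly two faces, traversed forwards by one and backwards
  by the other; consequently the traversal chain of a word `w` with `mk w = conjProd L` is the
  boundary of the `2`-chain `chainOf L`: `trav 1 w e = chainOf L (Fplus e) - chainOf L (Fminus e)`
  (`trav_apply_eq_chainOf_sub`).

## References

* H. Zieschang, E. Vogt, H.-D. Coldewey, *Surfaces and Planar Discontinuous Groups*, LNM 835,
  Springer (1980), §5.4 (Thm. 5.4.2, Cor. 5.4.3). [ZieschangVogtColdewey1980]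
-/

noncomputable section

namespace Literature.Topology.FourManifolds

open Literature.GroupTheory.CombinatorialGroupTheory List

namespace SurfaceGroup

variable {g : ℕ}

/-! ## Prefix vertices of the relator -/

/-- The vertex of the relator path after `k` letters: the value of `r_g.take k` in `S_g`.
[folklore] -/
def rvtx (g : ℕ) (k : ℕ) : SurfaceGroup g := proj g (FreeGroup.mk ((surfaceWordStd g).take k))

/-- Unfolding `rvtx`. [folklore] -/
theorem rvtx_def (k : ℕ) : rvtx g k = proj g (FreeGroup.mk ((surfaceWordStd g).take k)) := rfl

/-- The relator path starts at `1`. [folklore] -/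
@[simp] theorem rvtx_zero : rvtx g 0 = 1 := by
  rw [rvtx, take_zero, proj_mk_nil]

/-- Past its end the relator path stays at `1`. [folklore] -/
theorem rvtx_of_le {k : ℕ} (hk : 4 * g ≤ k) : rvtx g k = 1 := by
  rw [rvtx, take_of_length_le (by rwa [length_surfaceWordStd]), proj_mk_surfaceWordStd]

/-- The relator path is closed. [folklore] -/
@[simp] theorem rvtx_length : rvtx g (4 * g) = 1 := rvtx_of_le le_rfl

/-- The vertices of the relator word read from `F`. [folklore] -/
theorem vtx_surfaceWordStd (F : SurfaceGroup g) (k : ℕ) : vtx F (surfaceWordStd g) k = F * rvtx g k := rfl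

/-- **The relator path is simple**: its first `4g` vertices are pairwise distinct. [folklore] -/
theorem rvtx_injective {k l : ℕ} (hk : k < 4 * g) (hl : l < 4 * g) (h : rvtx g k = rvtx g l) : k = l :=
  proj_mk_take_injective hk hl h

/-- Equal vertices of the relator path at indices `a < 4g`, `b ≤ 4g`: equal indices, or the two
ends. [folklore] -/
theorem eq_or_eq_of_rvtx_eq {a b : ℕ} (ha : a < 4 * g) (hb : b ≤ 4 * g) (h : rvtx g a = rvtx g b) :
    a = b ∨ (a = 0 ∧ b = 4 * g) := by
  rcases hb.lt_or_eq with hb | rfl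
  · exact Or.inl (rvtx_injective ha hb h)
  · rw [rvtx_length, ← rvtx_zero] at h
    exact Or.inr ⟨rvtx_injective ha (by omega) h, rfl⟩

/-- The vertices inside the `i`-th block. [folklore] -/
theorem rvtx_block (i : Fin g) {t : ℕ} (ht : t ≤ 4) :
    rvtx g (4 * i + t) = rvtx g (4 * i) * proj g (FreeGroup.mk ((handleBlock i).take t)) := by
  have h1 := proj_mk_take_surfaceWordStd (g := g) i.isLt ht
  have h0 := proj_mk_take_surfaceWordStd (g := g) i.isLt (Nat.zero_le 4)
  rw [take_zero, ← FreeGroup.one_eq_mk, map_one, mul_one, add_zero] at h0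
  rw [rvtx, rvtx, h1, h0]

/-- After `aᵢ`. [folklore] -/
theorem rvtx_block_one (i : Fin g) : rvtx g (4 * i + 1) = rvtx g (4 * i) * gen (i, false) := by
  rw [rvtx_block i (by norm_num)]
  simp [handleBlock]

/-- After `aᵢ bᵢ`. [folklore] -/
theorem rvtx_block_two (i : Fin g) :
    rvtx g (4 * i + 2) = rvtx g (4 * i) * (gen (i, false) * gen (i, true)) := by
  rw [rvtx_block i (by norm_num)]
  simp [handleBlock, proj_mk_cons]

/-- After `aᵢ bᵢ aᵢ⁻¹`. [folklore] -/
theorem rvtx_block_three (i : Fin g) :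
    rvtx g (4 * i + 3) = rvtx g (4 * i) * (gen (i, false) * (gen (i, true) * (gen (i, false))⁻¹)) := by
  rw [rvtx_block i (by norm_num)]
  simp [handleBlock, proj_mk_cons]

/-- After the whole block `aᵢ bᵢ aᵢ⁻¹ bᵢ⁻¹`. [folklore] -/
theorem rvtx_block_four (i : Fin g) :
    rvtx g (4 * i + 4) =
      rvtx g (4 * i) * (gen (i, false) * (gen (i, true) * ((gen (i, false))⁻¹ * (gen (i, true))⁻¹))) := by
  rw [rvtx_block i (by norm_num)]
  simp [handleBlock, proj_mk_cons]

/-! ## Positions of the letters in the relator word -/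

/-- The position of the letter `ℓ` in `r_g`: `aᵢ` at `4i`, `bᵢ` at `4i+1`, `aᵢ⁻¹` at `4i+2`,
`bᵢ⁻¹` at `4i+3`. [folklore] -/
def pos (ℓ : surfaceGen g × Bool) : ℕ :=
  4 * (ℓ.1.1 : ℕ) + (if ℓ.1.2 then 1 else 0) + (if ℓ.2 then 0 else 2)

/-- Position of `aᵢ`. [folklore] -/
@[simp] theorem pos_a_true (i : Fin g) : pos ((i, false), true) = 4 * i := by simp [pos]

/-- Position of `bᵢ`. [folklore] -/
@[simp] theorem pos_b_true (i : Fin g) : pos ((i, true), true) = 4 * i + 1 := by simp [pos]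

/-- Position of `aᵢ⁻¹`. [folklore] -/
@[simp] theorem pos_a_false (i : Fin g) : pos ((i, false), false) = 4 * i + 2 := by simp [pos]

/-- Position of `bᵢ⁻¹`. [folklore] -/
@[simp] theorem pos_b_false (i : Fin g) : pos ((i, true), false) = 4 * i + 3 := by simp [pos]

/-- Positions are `< 4g`. [folklore] -/
theorem pos_lt (ℓ : surfaceGen g × Bool) : pos ℓ < 4 * g := by
  have := ℓ.1.1.isLt
  unfold pos
  split_ifs <;> omega

/-- `pos` is injective. [folklore] -/
theorem pos_injective : Function.Injective (pos (g := g)) := by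
  rintro ⟨⟨i, _ | _⟩, _ | _⟩ ⟨⟨j, _ | _⟩, _ | _⟩ h <;>
    simp only [pos_a_true, pos_b_true, pos_a_false, pos_b_false] at h <;>
    first
    | omega
    | (have hij : (i : ℕ) = j := by omega
       simp [Fin.ext_iff, hij])

/-- **Reading a letter of the relator advances the relator path**: `rvtx (pos ℓ + 1) = rvtx (pos ℓ) · ℓ`.
[folklore] -/
theorem rvtx_pos_succ (ℓ : surfaceGen g × Bool) : rvtx g (pos ℓ + 1) = rvtx g (pos ℓ) * lval ℓ := by
  obtain ⟨⟨i, _ | _⟩, _ | _⟩ := ℓ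
  · rw [pos_a_false, lval_false, show 4 * (i : ℕ) + 2 + 1 = 4 * i + 3 by ring, rvtx_block_three,
      rvtx_block_two]
    simp [mul_assoc]
  · rw [pos_a_true, lval_true, rvtx_block_one]
  · rw [pos_b_false, lval_false, show 4 * (i : ℕ) + 3 + 1 = 4 * i + 4 by ring, rvtx_block_four,
      rvtx_block_three]
    simp [mul_assoc]
  · rw [pos_b_true, lval_true, show 4 * (i : ℕ) + 1 + 1 = 4 * i + 2 by ring, rvtx_block_two,
      rvtx_block_one, mul_assoc]

/-- The length of a concatenation of `m` blocks. [folklore] -/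
theorem length_flatMap_handleBlock (l : List (Fin g)) : (l.flatMap handleBlock).length = 4 * l.length := by
  induction l with
  | nil => rfl
  | cons i l ih => rw [flatMap_cons, length_append, ih, length_handleBlock, length_cons]; ring

/-- The letters of the relator word: letter `4i + t` is letter `t` of block `i`. [folklore] -/
theorem getElem_surfaceWordStd {k : ℕ} (i : Fin g) {t : ℕ} (ht : t < 4) (hk : k = 4 * (i : ℕ) + t)
    {h : k < (surfaceWordStd g).length} :
    (surfaceWordStd g)[k] = (handleBlock i)[t]'(by rw [length_handleBlock]; exact ht) := by
  subst hk
  have hs := take_surfaceWordStd (g := g) i.isLt (show t + 1 ≤ 4 by omega)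
  have hA : (((finRange g).take i).flatMap handleBlock).length = 4 * i := by
    rw [length_flatMap_handleBlock, length_take, length_finRange, Nat.min_eq_left i.isLt.le]
  have h1 : ((surfaceWordStd g).take (4 * i + (t + 1)))[4 * (i : ℕ) + t]'(by
      rw [length_take, length_surfaceWordStd]; have := i.isLt; omega) = (surfaceWordStd g)[4 * (i : ℕ) + t] :=
    getElem_take
  rw [← h1, getElem_of_eq hs, getElem_append_right (by omega)]
  simp only [hA, Nat.add_sub_cancel_left, getElem_take]

/-- **The letter at position `pos ℓ` is `ℓ`.** [folklore] -/
theorem getElem_pos (ℓ : surfaceGen g × Bool) {h : pos ℓ < (surfaceWordStd g).length} :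
    (surfaceWordStd g)[pos ℓ] = ℓ := by
  obtain ⟨⟨i, _ | _⟩, _ | _⟩ := ℓ
  · exact (getElem_surfaceWordStd i (t := 2) (by norm_num) (pos_a_false i)).trans rfl
  · exact (getElem_surfaceWordStd i (t := 0) (by norm_num) (pos_a_true i)).trans rfl
  · exact (getElem_surfaceWordStd i (t := 3) (by norm_num) (pos_b_false i)).trans rfl
  · exact (getElem_surfaceWordStd i (t := 1) (by norm_num) (pos_b_true i)).trans rfl

/-! ## The two faces at an edge -/

/-- The face whose boundary reads the letter `ℓ` when leaving the vertex `u` ("same-direction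
face" of the traversal `(u, ℓ)`). [cite: ZieschangVogtColdewey1980, §5.4] -/
def sface (u : SurfaceGroup g) (ℓ : surfaceGen g × Bool) : SurfaceGroup g := u * (rvtx g (pos ℓ))⁻¹

/-- The other face at the edge along which `ℓ` leaves `u`: its boundary arrives at `u` reading
`ℓ⁻¹` ("opposite face" of the traversal `(u, ℓ)`). [cite: ZieschangVogtColdewey1980, §5.4] -/
def oface (u : SurfaceGroup g) (ℓ : surfaceGen g × Bool) : SurfaceGroup g :=
  u * (rvtx g (pos (linv ℓ) + 1))⁻¹

/-- The face traversing the directed edge `e = (u, s)` forwards. [cite: ZieschangVogtColdewey1980, §5.4] -/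
def Fplus (e : Edge g) : SurfaceGroup g := sface e.1 (e.2, true)

/-- The face traversing the directed edge `e = (u, s)` backwards. [cite: ZieschangVogtColdewey1980, §5.4] -/
def Fminus (e : Edge g) : SurfaceGroup g := oface e.1 (e.2, true)

/-- Unfolding `sface`. [folklore] -/
theorem sface_def (u : SurfaceGroup g) (ℓ : surfaceGen g × Bool) : sface u ℓ = u * (rvtx g (pos ℓ))⁻¹ := rfl

/-- Unfolding `oface`. [folklore] -/
theorem oface_def (u : SurfaceGroup g) (ℓ : surfaceGen g × Bool) :
    oface u ℓ = u * (rvtx g (pos (linv ℓ) + 1))⁻¹ := rfl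

/-- `F` is the same-direction face of `(u, ℓ)` iff `u` is the vertex `pos ℓ` of the face `F`.
[folklore] -/
theorem eq_sface_iff (F u : SurfaceGroup g) (ℓ : surfaceGen g × Bool) :
    F = sface u ℓ ↔ F * rvtx g (pos ℓ) = u := eq_mul_inv_iff_mul_eq

/-- `F` is the opposite face of `(u, ℓ)` iff `u` is the vertex `pos ℓ⁻¹ + 1` of the face `F`.
[folklore] -/
theorem eq_oface_iff (F u : SurfaceGroup g) (ℓ : surfaceGen g × Bool) :
    F = oface u ℓ ↔ F * rvtx g (pos (linv ℓ) + 1) = u := eq_mul_inv_iff_mul_eq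

/-- Translating the vertex translates the same-direction face. [folklore] -/
theorem sface_mul (a u : SurfaceGroup g) (ℓ : surfaceGen g × Bool) : sface (a * u) ℓ = a * sface u ℓ :=
  mul_assoc _ _ _

/-- Translating the vertex translates the opposite face. [folklore] -/
theorem oface_mul (a u : SurfaceGroup g) (ℓ : surfaceGen g × Bool) : oface (a * u) ℓ = a * oface u ℓ :=
  mul_assoc _ _ _

/-- **The opposite face of a traversal is the same-direction face of the reverse traversal.**
[folklore] -/
theorem oface_eq_sface_linv (u : SurfaceGroup g) (ℓ : surfaceGen g × Bool) :
    oface u ℓ = sface (u * lval ℓ) (linv ℓ) := by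
  rw [oface, sface, rvtx_pos_succ, lval_linv, mul_inv_rev, inv_inv, mul_assoc]

/-- The same-direction face of a traversal is the opposite face of the reverse traversal.
[folklore] -/
theorem sface_eq_oface_linv (u : SurfaceGroup g) (ℓ : surfaceGen g × Bool) :
    sface u ℓ = oface (u * lval ℓ) (linv ℓ) := by
  rw [oface_eq_sface_linv, lval_linv, mul_inv_cancel_right, linv_linv]

/-- The faces of the edge of a positive letter. [folklore] -/
theorem Fplus_edgeOf_true (u : SurfaceGroup g) (s : surfaceGen g) : Fplus (edgeOf u (s, true)) = sface u (s, true) := by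
  rw [edgeOf_true]; rfl

/-- The faces of the edge of a positive letter. [folklore] -/
theorem Fminus_edgeOf_true (u : SurfaceGroup g) (s : surfaceGen g) : Fminus (edgeOf u (s, true)) = oface u (s, true) := by
  rw [edgeOf_true]; rfl

/-- The faces of the edge of a negative letter. [folklore] -/
theorem Fplus_edgeOf_false (u : SurfaceGroup g) (s : surfaceGen g) : Fplus (edgeOf u (s, false)) = oface u (s, false) := by
  rw [edgeOf_false, Fplus, oface_eq_sface_linv, lval_false]; rfl

/-- The faces of the edge of a negative letter. [folklore] -/
theorem Fminus_edgeOf_false (u : SurfaceGroup g) (s : surfaceGen g) : Fminus (edgeOf u (s, false)) = sface u (s, false) := by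
  rw [edgeOf_false, Fminus, sface_eq_oface_linv, lval_false]; rfl

/-- **The two faces at the edge of a traversal** are its same-direction face and its opposite face:
in this order if the letter is positive, swapped if it is negative. [folklore] -/
theorem Fplus_Fminus_edgeOf (u : SurfaceGroup g) (ℓ : surfaceGen g × Bool) :
    (ℓ.2 = true ∧ Fplus (edgeOf u ℓ) = sface u ℓ ∧ Fminus (edgeOf u ℓ) = oface u ℓ) ∨
      (ℓ.2 = false ∧ Fplus (edgeOf u ℓ) = oface u ℓ ∧ Fminus (edgeOf u ℓ) = sface u ℓ) := by
  obtain ⟨s, _ | _⟩ := ℓ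
  · exact Or.inr ⟨rfl, Fplus_edgeOf_false u s, Fminus_edgeOf_false u s⟩
  · exact Or.inl ⟨rfl, Fplus_edgeOf_true u s, Fminus_edgeOf_true u s⟩

/-- The unordered pair of faces at the edge of a traversal. [folklore] -/
theorem faces_edgeOf_iff (u : SurfaceGroup g) (ℓ : surfaceGen g × Bool) (F : SurfaceGroup g) :
    (F = Fplus (edgeOf u ℓ) ∨ F = Fminus (edgeOf u ℓ)) ↔ (F = sface u ℓ ∨ F = oface u ℓ) := by
  rcases Fplus_Fminus_edgeOf u ℓ with ⟨_, h1, h2⟩ | ⟨_, h1, h2⟩ <;> rw [h1, h2]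
  exact or_comm

/-! ## The two-faces lemma -/

/-- Splitting the relator word at the `i`-th block. [folklore] -/
theorem surfaceWordStd_split (i : Fin g) :
    surfaceWordStd g = (surfaceWordStd g).take (4 * i) ++
      (handleBlock i ++ ((finRange g).drop ((i : ℕ) + 1)).flatMap handleBlock) := by
  have ht : (surfaceWordStd g).take (4 * i) = ((finRange g).take i).flatMap handleBlock := by
    have := take_surfaceWordStd (g := g) i.isLt (Nat.zero_le 4)
    rwa [take_zero, append_nil, add_zero] at this
  have hi : (finRange g).drop i = i :: (finRange g).drop ((i : ℕ) + 1) := by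
    rw [drop_eq_getElem_cons (by simp), getElem_finRange]
    rfl
  conv_lhs => rw [surfaceWordStd_eq_flatMap, ← take_append_drop i (finRange g), hi, flatMap_append, flatMap_cons]
  rw [ht]

/-- The handle index of a letter of block `i` is `i`. [folklore] -/
theorem fst_fst_eq_of_mem_handleBlock {i : Fin g} {x : surfaceGen g × Bool} (hx : x ∈ handleBlock i) : x.1.1 = i := by
  simp only [handleBlock, mem_cons, not_mem_nil, or_false] at hx
  rcases hx with rfl | rfl | rfl | rfl <;> rfl

/-- Letters before block `i` belong to earlier handles. [folklore] -/
theorem fst_fst_ne_of_mem_take {i : Fin g} {x : surfaceGen g × Bool} (hx : x ∈ (surfaceWordStd g).take (4 * i)) :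
    x.1.1 ≠ i := by
  have ht : (surfaceWordStd g).take (4 * i) = ((finRange g).take i).flatMap handleBlock := by
    have := take_surfaceWordStd (g := g) i.isLt (Nat.zero_le 4)
    rwa [take_zero, append_nil, add_zero] at this
  rw [ht, mem_flatMap] at hx
  obtain ⟨j, hj, hxj⟩ := hx
  rw [fst_fst_eq_of_mem_handleBlock hxj]
  have := val_lt_of_mem_take_finRange hj
  exact fun h => by rw [h] at this; exact lt_irrefl _ this

/-- Letters after block `i` belong to later handles. [folklore] -/
theorem fst_fst_ne_of_mem_drop {i : Fin g} {x : surfaceGen g × Bool}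
    (hx : x ∈ ((finRange g).drop ((i : ℕ) + 1)).flatMap handleBlock) : x.1.1 ≠ i := by
  rw [mem_flatMap] at hx
  obtain ⟨j, hj, hxj⟩ := hx
  rw [fst_fst_eq_of_mem_handleBlock hxj]
  obtain ⟨n, hn, rfl⟩ := mem_iff_getElem.1 hj
  intro h
  rw [getElem_drop, getElem_finRange, Fin.ext_iff] at h
  simp at h
  omega

/-- Only block `i` of the face boundary meets the edges with symbol in handle `i`. [folklore] -/
theorem faceB_apply_eq_trav_handleBlock (F u : SurfaceGroup g) (i : Fin g) (c : Bool) :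
    faceB F (u, (i, c)) = trav (F * rvtx g (4 * i)) (handleBlock i) (u, (i, c)) := by
  rw [faceB, surfaceWordStd_split i, trav_append, trav_append, Finsupp.add_apply, Finsupp.add_apply,
    trav_apply_eq_zero_of_forall_fst_ne _ _ _ (fun ℓ hℓ h => fst_fst_ne_of_mem_take hℓ (by simpa using congrArg Prod.fst h)),
    trav_apply_eq_zero_of_forall_fst_ne _ (((finRange g).drop ((i : ℕ) + 1)).flatMap handleBlock) _
      (fun ℓ hℓ h => fst_fst_ne_of_mem_drop hℓ (by simpa using congrArg Prod.fst h)),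
    zero_add, add_zero]
  rfl

open Classical in
/-- The block `aᵢ bᵢ aᵢ⁻¹ bᵢ⁻¹` read from `v`, evaluated at an `aᵢ`-edge. [folklore] -/
theorem trav_handleBlock_apply_false (v u : SurfaceGroup g) (i : Fin g) :
    trav v (handleBlock i) (u, (i, false)) =
      (if v = u then 1 else 0) - (if v * (gen (i, false) * (gen (i, true) * (gen (i, false))⁻¹)) = u then 1 else 0) := by
  simp [handleBlock, trav_cons, Finsupp.single_apply, bsign, mul_assoc, sub_eq_add_neg]

open Classical in
/-- The block `aᵢ bᵢ aᵢ⁻¹ bᵢ⁻¹` read from `v`, evaluated at a `bᵢ`-edge. [folklore] -/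
theorem trav_handleBlock_apply_true (v u : SurfaceGroup g) (i : Fin g) :
    trav v (handleBlock i) (u, (i, true)) =
      (if v * gen (i, false) = u then 1 else 0) -
        (if v * (gen (i, false) * (gen (i, true) * ((gen (i, false))⁻¹ * (gen (i, true))⁻¹))) = u then 1 else 0) := by
  simp [handleBlock, trav_cons, Finsupp.single_apply, bsign, mul_assoc, sub_eq_add_neg]

open Classical in
/-- **Two-faces lemma**: every directed edge `e` lies on the boundary of exactly two faces,
`Fplus e` traversing it forwards and `Fminus e` traversing it backwards.
[cite: ZieschangVogtColdewey1980, §5.4] -/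
theorem faceB_apply (F : SurfaceGroup g) (e : Edge g) :
    faceB F e = (if F = Fplus e then 1 else 0) - (if F = Fminus e then 1 else 0) := by
  obtain ⟨u, i, c⟩ := e
  have hP : F = Fplus (u, (i, c)) ↔ F * rvtx g (pos ((i, c), true)) = u := eq_sface_iff _ _ _
  have hM : F = Fminus (u, (i, c)) ↔ F * rvtx g (pos ((i, c), false) + 1) = u := eq_oface_iff _ _ _
  simp only [hP, hM]
  cases c
  · rw [faceB_apply_eq_trav_handleBlock, trav_handleBlock_apply_false, pos_a_true, pos_a_false,
      show 4 * (i : ℕ) + 2 + 1 = 4 * i + 3 by ring, rvtx_block_three]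
    simp only [← mul_assoc]
  · rw [faceB_apply_eq_trav_handleBlock, trav_handleBlock_apply_true, pos_b_true, pos_b_false,
      show 4 * (i : ℕ) + 3 + 1 = 4 * i + 4 by ring, rvtx_block_four, rvtx_block_one]
    simp only [← mul_assoc]

/-- The forward face of `e` traverses `e` forwards (if the two faces differ). [folklore] -/
theorem faceB_Fplus (e : Edge g) (h : Fplus e ≠ Fminus e) : faceB (Fplus e) e = 1 := by
  classical
  rw [faceB_apply, if_pos rfl, if_neg h]; rfl

/-- The backward face of `e` traverses `e` backwards (if the two faces differ). [folklore] -/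
theorem faceB_Fminus (e : Edge g) (h : Fplus e ≠ Fminus e) : faceB (Fminus e) e = -1 := by
  classical
  rw [faceB_apply, if_neg (Ne.symm h), if_pos rfl]; rfl

/-- No other face meets `e`. [folklore] -/
theorem faceB_apply_of_ne (F : SurfaceGroup g) (e : Edge g) (h₁ : F ≠ Fplus e) (h₂ : F ≠ Fminus e) :
    faceB F e = 0 := by
  classical
  rw [faceB_apply, if_neg h₁, if_neg h₂]; rfl

/-! ## The traversal chain of a product of conjugates is a boundary -/

open Classical in
/-- Summing signed two-faces values over an expression. [folklore] -/
theorem sum_map_bsign_mul_sub (L : List (FreeGroup (surfaceGen g) × Bool)) (A B : SurfaceGroup g) :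
    (L.map fun p => bsign p.2 * ((if proj g p.1 = A then (1 : ℤ) else 0) - (if proj g p.1 = B then 1 else 0))).sum =
      (L.map fun p => if proj g p.1 = A then bsign p.2 else 0).sum -
        (L.map fun p => if proj g p.1 = B then bsign p.2 else 0).sum := by
  induction L with
  | nil => simp
  | cons p L ih =>
    rw [map_cons, sum_cons, ih, map_cons, sum_cons, map_cons, sum_cons]
    simp only [mul_sub, mul_ite, mul_one, mul_zero]
    abel

/-- **The traversal chain of `conjProd L` is the boundary of the `2`-chain `chainOf L`**: its value
on an edge is the multiplicity of the forward face minus that of the backward face.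
[cite: ZieschangVogtColdewey1980, §5.4] -/
theorem travF_conjProd_apply_eq_sub (L : List (FreeGroup (surfaceGen g) × Bool)) (e : Edge g) :
    travF 1 (conjProd L) e = chainOf L (Fplus e) - chainOf L (Fminus e) := by
  classical
  rw [travF_conjProd_apply, chainOf_apply, chainOf_apply, ← sum_map_bsign_mul_sub]
  congr 1
  refine map_congr_left fun p _ => ?_
  rw [faceB_apply]

/-- The same for a word spelling `conjProd L`. [folklore] -/
theorem trav_apply_eq_chainOf_sub {w : List (surfaceGen g × Bool)} {L : List (FreeGroup (surfaceGen g) × Bool)}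
    (hL : FreeGroup.mk w = conjProd L) (e : Edge g) :
    trav 1 w e = chainOf L (Fplus e) - chainOf L (Fminus e) := by
  rw [← travF_mk, hL, travF_conjProd_apply_eq_sub]

end SurfaceGroup

end Literature.Topology.FourManifolds
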